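import Summits.BirchSwinnertonDyer.BirchSwinnertonDyer.Theorems.KimAtThreeFineKatoDefinedLambdaPosition
import Summits.BirchSwinnertonDyer.BirchSwinnertonDyer.Theorems.KimAtThreeFineKatoDefinedLambdaC3Uniform
import HarnessLib

/-!
# The PRINT-SHAPED Kato hypothesis of crux 19560 with the 3-adic POSITION clause: hKatoPrintPos₀ ⟹ hKatoDefPos
# (cell `bsd-addord`, seat w2-acc4 gen 6; `--supports stmt-BirchSwinnertonDyer-19560`, helper)

HONEST FRAMING.  ONE tool theorem; no definition, no named fact, no instance, no `sorry`.  hKatoPrintPos₀ is DISPLAYED; (P123)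
`cupLogInjective_and_hasDualExp_of_isDeRham`, (DR) `isDeRham_restrictedRationalTateRep`, (S5b)
`exists_smul_range_expStarCoord_iff_trace_log` are cite-only facts taken as hypotheses (D-0014).  Nothing is closed or booked;
BSD / 19560 are NOT proved here; the LEAD (kim3) assembles.

WHAT.  **hKatoPrintPos₀** := the 19560 binders (tower-surjective `W`, the Kato stratum `Addv`/`3 ∤ c₃`/`E(ℚ₃)[3] = 0`, optimal
`P` at the conductor with `3 ∤ c_P`) → «∃ dK ι κK (charts w₀ Ψ hΨ g hg dw hinjw hexw over the levels (k, r)), κK ≠ 0 ∧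
POS(dK, κK) ∧ (∀ k r, (RES₀)(dK, dw k r)) ∧ ∀ (c, d, a, A) guards, ∃ z x, (C1) ∧ (C2) ∧ (C4 for the DEFINED `katoLambda`) ∧ (C5)»
— i.e. w2-c3 gen 9's hKatoPᵘ (`KimAtThreeDeepUpperOfKatoPrint` l.121–206, the deep family's print-shaped residual: Kato 2004
(8.1.3)/8.12/13.3 [(C1)], §8.2/8.5 [(C2)], Thm 9.7 [(C4) over w2-acc5's `katoLambda`], Thm 6.6 (1) [(C5)]) VERBATIM, under the
19560 binders, plus the ONE extra conjunct POS(dK, κK) := `∃ u : ℚ, u = κK ∧ ∀ hinj hex (e ≠ 0), hdual(e • dK) → v₃(u) = v(ι₃ e)`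
(the 3-adic position of Kato's generator relative to the duality line — the Manin / `3 ∤ c_P` content; duality only as an
antecedent).  `katoDefPos_of_katoPrintPos_of_facts : (P123) → (DR) → (S5b) → hKatoPrintPos₀ → hKatoDefPos` reassembles
`ZetaBody` for `katoLambda`: (C3a)/(C3b) at every level are w2-acc5's `zetaBody_C3_katoLambda_of_ne_zero` (keyed on a class with
`exp*_{dK} ≠ 0`, which (S5b) supplies on every row: w2-c3's `exists_expStarOmegaAt_ne_zero_of_facts`; `hinj`/`hex` at `v₃` from
(P123)/(DR): `hinj_hex_of_facts`).  With `KimAtThreeFineKatoDefinedLambdaPosition(Crux)`: **crux ⟸ {S5a, S5b, S5b-tower, P123,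
DR} [cite] ∧ hKatoPrintPos₀** (sequel `KimAtThreeFineKatoPrintPositionCrux`) — the displayed residual of 19560 is then Kato's
four printed clauses over DEFINED objects + POS: no abstract functional, no (DEF₀)/(C3), no [BK90] assertion, no R-κ unit clause.

References: [Kato2004Asterisque] (8.1.3) p. 180, 8.12 p. 186, §8.2/8.5, §9.4/9.7 pp. 188–189, 6.6 (1) p. 163, 13.3 pp. 224–225;
[Kato1993LNM1553] II §1.2.4, 1.3.5, 1.4.1; [BlochKato1990] §3 Prop. 3.8, Ex. 3.11; [CasselsFrohlichANT1967] Ch. II §10, Ch. VII §1.1.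
-/

noncomputable section
-- the cell's Theorems namespace `Summit.BirchSwinnertonDyer.BirchSwinnertonDyer.…` repeats the summit name by design (D-0017)
set_option linter.dupNamespace false

open scoped Classical NumberField TensorProduct ContRepresentation Pointwise
open Field ValuativeRel Function IsDedekindDomain NumberField WeierstrassCurve Literature.NumberTheory.EllipticCurves
open Literature.NumberTheory.GaloisRepresentations Literature.NumberTheory.GaloisRepresentations.DiscreteGaloisModule
open Literature.NumberTheory.GaloisCohomology Literature.NumberTheory.GaloisRepresentations.PeriodRingData
open Literature.NumberTheory.PAdicHodge Literature.NumberTheory.EllipticCurves.ModularForms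
open Literature.NumberTheory.EllipticCurves.Rank1Residual Literature.NumberTheory.EllipticCurves.Kato2004
open Literature.NumberTheory.EllipticCurves.Kato2004.EulerSystemValues Literature.NumberTheory.AdelicBaseChange
open Literature.NumberTheory.Automorphic Summit.BirchSwinnertonDyer.Rank1Residual.GaloisImage
open Summit.BirchSwinnertonDyer.Rank1Residual.Additive.LocalLog Summit.BirchSwinnertonDyer.BirchSwinnertonDyer.Theorems
open KimAtThreeFineKatoPerFactorDefined KimAtThreeDeepLowerExpStarOmega KimAtThreeDeepLowerExpStarOmegaPlace
open KimAtThreeFineKatoPerFactorPlaces KimAtThreeDeepUpperExpStarFacts KimAtThreeDeepUpperExpStarFactsCanonical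
open KimAtThreeDeepUpperZetaBodyC3Uniform KimAtThreeFineKatoDefinedLambda KimAtThreeFineKatoDefinedLambdaC3Uniform
open KimAtThreeFineKatoDefinedLambdaPosition Rat.HeightOneSpectrum

namespace Summit.BirchSwinnertonDyer.BirchSwinnertonDyer.Theorems.KimAtThreeFineKatoPrintPosition

set_option backward.isDefEq.respectTransparency false in
set_option maxHeartbeats 1600000 in
/-- **hKatoDefPos from (P123), (DR), (S5b) and the print-shaped hKatoPrintPos₀**: the outer data `dK`, POS, the charts
and (RES₀) pass through; `ZetaBody` for `Λ := katoLambda(charts)` is reassembled from (C1)(C2)(C4)(C5) and the KERNEL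
clauses (C3a)/(C3b) (`zetaBody_C3_katoLambda_of_ne_zero`, fed by `exists_expStarOmegaAt_ne_zero_of_facts` and
`hinj_hex_of_facts`).  hKatoPrintPos₀ displayed, three facts cite-only; closes nothing (`maxHeartbeats 1600000`: two large
displayed packages in ONE signature).
[cite: Kato2004Asterisque, (8.1.3) (p. 180), Prop. 8.12 (p. 186), §9.4 and Thm. 9.7 (pp. 188–189), Thm. 6.6 (1) (p. 163), Ex. 13.3 (pp. 224–225)]
[cite: Kato1993LNM1553, Ch. II §1.2.4 and Thm. 1.4.1] [cite: BlochKato1990, §3 (Prop. 3.8, Ex. 3.11)] -/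
theorem katoDefPos_of_katoPrintPos_of_facts (hP : cupLogInjective_and_hasDualExp_of_isDeRham)
    (hDR : isDeRham_restrictedRationalTateRep) (hT : exists_smul_range_expStarCoord_iff_trace_log)
    (hKatoPrintPos₀ : ∀ (W : WeierstrassCurve ℚ) [W.IsElliptic] [W.IsGloballyMinimal]
      [ContinuousSMul ℤ_[3] (W.tateModule 3)] [Module.Free ℤ_[3] (W.tateModule 3)]
      [Module.Finite ℤ_[3] (W.tateModule 3)],
      (∀ m : ℕ, W.HasSurjectiveModNGaloisRep (3 ^ m : ℕ)) →
      (haveI : Fact (Nat.Prime 3) := ⟨Nat.prime_three⟩; Addv W 3) →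
      ¬ 3 ∣ (W.baseChange ℚ_[3]).localTamagawaNumber ℤ_[3] →
      Nat.card {Q : (W.baseChange ℚ_[3]).toAffine.Point // (3 : ℕ) • Q = 0} = 1 →
      ∀ {N : ℕ} [NeZero N] (P : ModularParametrizationData W N), N = W.conductorNorm ℤ →
        (∀ z ∈ P.L.lattice, ∃ w ∈ periodLattice P.f, z = P.c * w) →
        ¬ (3 : ℤ) ∣ P.maninConstant →
        haveI : Fact (((3 : ℕ) : 𝓞 ℚ) ∈ ((Rat.HeightOneSpectrum.primesEquiv (R := 𝓞 ℚ)).symm ⟨3, Fact.out⟩).asIdeal) :=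
          ⟨(natCast_mem_asIdeal_iff_eq_primesEquiv_symm _ Nat.prime_three).mpr rfl⟩
        letI := valuativeRelPlace ((Rat.HeightOneSpectrum.primesEquiv (R := 𝓞 ℚ)).symm ⟨3, Fact.out⟩)
        letI := topologicalSpacePlace ((Rat.HeightOneSpectrum.primesEquiv (R := 𝓞 ℚ)).symm ⟨3, Fact.out⟩)
        haveI := isNonarchimedeanLocalField_place ((Rat.HeightOneSpectrum.primesEquiv (R := 𝓞 ℚ)).symm ⟨3, Fact.out⟩)
        haveI := charZero_place ((Rat.HeightOneSpectrum.primesEquiv (R := 𝓞 ℚ)).symm ⟨3, Fact.out⟩)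
        letI := padicAlgebraPlace 3 ((Rat.HeightOneSpectrum.primesEquiv (R := 𝓞 ℚ)).symm ⟨3, Fact.out⟩)
        haveI := fact_not_isUnit_place 3 ((Rat.HeightOneSpectrum.primesEquiv (R := 𝓞 ℚ)).symm ⟨3, Fact.out⟩)
        haveI := isAdicComplete_place 3 ((Rat.HeightOneSpectrum.primesEquiv (R := 𝓞 ℚ)).symm ⟨3, Fact.out⟩)
        ∃ (dK : LocalNeronLineAt W 3 ((Rat.HeightOneSpectrum.primesEquiv (R := 𝓞 ℚ)).symm ⟨3, Fact.out⟩))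
          (ι : (n : ℕ) → (CyclotomicField n ℚ →+* ℂ)) (κK : ℝ)
          (w₀ : ∀ (k : ℕ) (r : Finset (HeightOneSpectrum (𝓞 ℚ))), (((Rat.HeightOneSpectrum.primesEquiv (R := 𝓞 ℚ)).symm ⟨3, Fact.out⟩).Extension (𝓞 (CyclotomicField (cycLevel 3 k r) ℚ))))
          (Ψ : ∀ (k : ℕ) (r : Finset (HeightOneSpectrum (𝓞 ℚ))), ℚ_[3] ⊗[ℚ] CyclotomicField (cycLevel 3 k r) ℚ ≃ₐ[ℚ]
            (Π w : (((Rat.HeightOneSpectrum.primesEquiv (R := 𝓞 ℚ)).symm ⟨3, Fact.out⟩).Extension (𝓞 (CyclotomicField (cycLevel 3 k r) ℚ))), w.1.adicCompletion (CyclotomicField (cycLevel 3 k r) ℚ)))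
          (hΨ : ∀ (k : ℕ) (r : Finset (HeightOneSpectrum (𝓞 ℚ))) (s : ℚ_[3]) (x : CyclotomicField (cycLevel 3 k r) ℚ) (w : (((Rat.HeightOneSpectrum.primesEquiv (R := 𝓞 ℚ)).symm ⟨3, Fact.out⟩).Extension (𝓞 (CyclotomicField (cycLevel 3 k r) ℚ)))),
            Ψ k r (s ⊗ₜ[ℚ] x) w =
              algebraMap (CyclotomicField (cycLevel 3 k r) ℚ) (w.1.adicCompletion (CyclotomicField (cycLevel 3 k r) ℚ)) x *
              algebraMap (((Rat.HeightOneSpectrum.primesEquiv (R := 𝓞 ℚ)).symm ⟨3, Fact.out⟩).adicCompletion ℚ) (w.1.adicCompletion (CyclotomicField (cycLevel 3 k r) ℚ))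
                ((Padic.adicCompletionEquiv (𝓞 ℚ) ⟨3, Fact.out⟩) s))
          (g : ∀ (k : ℕ) (r : Finset (HeightOneSpectrum (𝓞 ℚ))), (((Rat.HeightOneSpectrum.primesEquiv (R := 𝓞 ℚ)).symm ⟨3, Fact.out⟩).Extension (𝓞 (CyclotomicField (cycLevel 3 k r) ℚ))) → absoluteGaloisGroup ℚ)
          (hg : ∀ (k : ℕ) (r : Finset (HeightOneSpectrum (𝓞 ℚ))) (w : (((Rat.HeightOneSpectrum.primesEquiv (R := 𝓞 ℚ)).symm ⟨3, Fact.out⟩).Extension (𝓞 (CyclotomicField (cycLevel 3 k r) ℚ)))),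
            sigma (cycLevel 3 k r) (modNCyclotomicCharacter ℚ (cycLevel 3 k r) (g k r w)) • w.1 = (w₀ k r).1)
          (dw : ∀ (k : ℕ) (r : Finset (HeightOneSpectrum (𝓞 ℚ))),
            letI := LocalField.charZero_adicCompletion (w₀ k r).1
            letI := LocalField.adicCompletionPadicAlgebra (w₀ k r).1 3 (three_mem_asIdeal_extension _ (w₀ k r))
            haveI : Fact (¬ IsUnit ((3 : ℕ) : integerC ((w₀ k r).1.adicCompletion (CyclotomicField (cycLevel 3 k r) ℚ)))) :=
              ⟨not_isUnit_natCast_integerC (LocalField.valuation_adicCompletion_natCast_lt_one (w₀ k r).1 3 (three_mem_asIdeal_extension _ (w₀ k r)))⟩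
            haveI := isAdicComplete_integerC_natCast (LocalField.valuation_adicCompletion_natCast_lt_one (w₀ k r).1 3 (three_mem_asIdeal_extension _ (w₀ k r)))
            LocalNeronLine W (LocalField.valuation_adicCompletion_natCast_lt_one (w₀ k r).1 3 (three_mem_asIdeal_extension _ (w₀ k r))) ((galRestrictPlace ((Rat.HeightOneSpectrum.primesEquiv (R := 𝓞 ℚ)).symm ⟨3, Fact.out⟩)).comp (absGaloisRestrict (((Rat.HeightOneSpectrum.primesEquiv (R := 𝓞 ℚ)).symm ⟨3, Fact.out⟩).adicCompletion ℚ) ((w₀ k r).1.adicCompletion (CyclotomicField (cycLevel 3 k r) ℚ)))))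
          (hinjw : ∀ (k : ℕ) (r : Finset (HeightOneSpectrum (𝓞 ℚ))),
            letI := LocalField.charZero_adicCompletion (w₀ k r).1
            letI := LocalField.adicCompletionPadicAlgebra (w₀ k r).1 3 (three_mem_asIdeal_extension _ (w₀ k r))
            haveI : Fact (¬ IsUnit ((3 : ℕ) : integerC ((w₀ k r).1.adicCompletion (CyclotomicField (cycLevel 3 k r) ℚ)))) :=
              ⟨not_isUnit_natCast_integerC (LocalField.valuation_adicCompletion_natCast_lt_one (w₀ k r).1 3 (three_mem_asIdeal_extension _ (w₀ k r)))⟩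
            haveI := isAdicComplete_integerC_natCast (LocalField.valuation_adicCompletion_natCast_lt_one (w₀ k r).1 3 (three_mem_asIdeal_extension _ (w₀ k r)))
            (bdRPeriodRingData (LocalField.valuation_adicCompletion_natCast_lt_one (w₀ k r).1 3 (three_mem_asIdeal_extension _ (w₀ k r)))).CupLogInjective (logCyclotomic 3) (localRationalTateRep W 3 ((galRestrictPlace ((Rat.HeightOneSpectrum.primesEquiv (R := 𝓞 ℚ)).symm ⟨3, Fact.out⟩)).comp (absGaloisRestrict (((Rat.HeightOneSpectrum.primesEquiv (R := 𝓞 ℚ)).symm ⟨3, Fact.out⟩).adicCompletion ℚ) ((w₀ k r).1.adicCompletion (CyclotomicField (cycLevel 3 k r) ℚ))))))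
          (hexw : ∀ (k : ℕ) (r : Finset (HeightOneSpectrum (𝓞 ℚ))),
            letI := LocalField.charZero_adicCompletion (w₀ k r).1
            letI := LocalField.adicCompletionPadicAlgebra (w₀ k r).1 3 (three_mem_asIdeal_extension _ (w₀ k r))
            haveI : Fact (¬ IsUnit ((3 : ℕ) : integerC ((w₀ k r).1.adicCompletion (CyclotomicField (cycLevel 3 k r) ℚ)))) :=
              ⟨not_isUnit_natCast_integerC (LocalField.valuation_adicCompletion_natCast_lt_one (w₀ k r).1 3 (three_mem_asIdeal_extension _ (w₀ k r)))⟩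
            haveI := isAdicComplete_integerC_natCast (LocalField.valuation_adicCompletion_natCast_lt_one (w₀ k r).1 3 (three_mem_asIdeal_extension _ (w₀ k r)))
            ∀ z : contOneCocycles (localRationalTateRep W 3 ((galRestrictPlace ((Rat.HeightOneSpectrum.primesEquiv (R := 𝓞 ℚ)).symm ⟨3, Fact.out⟩)).comp (absGaloisRestrict (((Rat.HeightOneSpectrum.primesEquiv (R := 𝓞 ℚ)).symm ⟨3, Fact.out⟩).adicCompletion ℚ) ((w₀ k r).1.adicCompletion (CyclotomicField (cycLevel 3 k r) ℚ))))).toTopRep,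
              (bdRPeriodRingData (LocalField.valuation_adicCompletion_natCast_lt_one (w₀ k r).1 3 (three_mem_asIdeal_extension _ (w₀ k r)))).HasDualExp (logCyclotomic 3) (localRationalTateRep W 3 ((galRestrictPlace ((Rat.HeightOneSpectrum.primesEquiv (R := 𝓞 ℚ)).symm ⟨3, Fact.out⟩)).comp (absGaloisRestrict (((Rat.HeightOneSpectrum.primesEquiv (R := 𝓞 ℚ)).symm ⟨3, Fact.out⟩).adicCompletion ℚ) ((w₀ k r).1.adicCompletion (CyclotomicField (cycLevel 3 k r) ℚ))))) fun σ => z.1 σ),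
          κK ≠ 0 ∧
          (∃ u : ℚ, (u : ℝ) = κK ∧
            ∀ (hinj : (bdRPeriodRingData (valuation_place_lt_one 3 ((Rat.HeightOneSpectrum.primesEquiv (R := 𝓞 ℚ)).symm ⟨3, Fact.out⟩))).CupLogInjective (logCyclotomic 3)
              (localRationalTateRep W 3 (galRestrictPlace ((Rat.HeightOneSpectrum.primesEquiv (R := 𝓞 ℚ)).symm ⟨3, Fact.out⟩))))
            (hex : ∀ z : contOneCocycles (localRationalTateRep W 3 (galRestrictPlace ((Rat.HeightOneSpectrum.primesEquiv (R := 𝓞 ℚ)).symm ⟨3, Fact.out⟩))).toTopRep,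
              (bdRPeriodRingData (valuation_place_lt_one 3 ((Rat.HeightOneSpectrum.primesEquiv (R := 𝓞 ℚ)).symm ⟨3, Fact.out⟩))).HasDualExp (logCyclotomic 3)
                (localRationalTateRep W 3 (galRestrictPlace ((Rat.HeightOneSpectrum.primesEquiv (R := 𝓞 ℚ)).symm ⟨3, Fact.out⟩))) fun σ => z.1 σ)
              (e : ((Rat.HeightOneSpectrum.primesEquiv (R := 𝓞 ℚ)).symm ⟨3, Fact.out⟩).adicCompletion ℚ) (he : e ≠ 0),
              (∀ a : ℚ_[3], (∃ y, (expStarOmegaPadicAt (dK.smul e he) hinj hex (((Padic.adicCompletionEquiv (𝓞 ℚ) ⟨3, Fact.out⟩).symm : (((Rat.HeightOneSpectrum.primesEquiv (R := 𝓞 ℚ)).symm ⟨3, Fact.out⟩).adicCompletion ℚ) →+* ℚ_[3]))) y = a) ↔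
                ∀ Q : (W.baseChange ℚ_[3]).toAffine.Point, ‖a * padicLog (W.baseChange ℚ_[3]) Q‖ ≤ 1) →
              padicValRat 3 u = ((((Padic.adicCompletionEquiv (𝓞 ℚ) ⟨3, Fact.out⟩).symm : (((Rat.HeightOneSpectrum.primesEquiv (R := 𝓞 ℚ)).symm ⟨3, Fact.out⟩).adicCompletion ℚ) →+* ℚ_[3])) e).valuation) ∧
          (∀ (k : ℕ) (r : Finset (HeightOneSpectrum (𝓞 ℚ))),
            letI := LocalField.charZero_adicCompletion (w₀ k r).1
            letI := LocalField.adicCompletionPadicAlgebra (w₀ k r).1 3 (three_mem_asIdeal_extension _ (w₀ k r))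
            haveI : Fact (¬ IsUnit ((3 : ℕ) : integerC ((w₀ k r).1.adicCompletion (CyclotomicField (cycLevel 3 k r) ℚ)))) :=
              ⟨not_isUnit_natCast_integerC (LocalField.valuation_adicCompletion_natCast_lt_one (w₀ k r).1 3 (three_mem_asIdeal_extension _ (w₀ k r)))⟩
            haveI := isAdicComplete_integerC_natCast (LocalField.valuation_adicCompletion_natCast_lt_one (w₀ k r).1 3 (three_mem_asIdeal_extension _ (w₀ k r)))
            ∀ (h : (tateLocalRep W 3 (Sum.inr ((Rat.HeightOneSpectrum.primesEquiv (R := 𝓞 ℚ)).symm ⟨3, Fact.out⟩))).cohomology 1),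
              expStarOmegaHom (LocalField.valuation_adicCompletion_natCast_lt_one (w₀ k r).1 3 (three_mem_asIdeal_extension _ (w₀ k r))) ((galRestrictPlace ((Rat.HeightOneSpectrum.primesEquiv (R := 𝓞 ℚ)).symm ⟨3, Fact.out⟩)).comp (absGaloisRestrict (((Rat.HeightOneSpectrum.primesEquiv (R := 𝓞 ℚ)).symm ⟨3, Fact.out⟩).adicCompletion ℚ) ((w₀ k r).1.adicCompletion (CyclotomicField (cycLevel 3 k r) ℚ)))) (dw k r) (hinjw k r) (hexw k r)
                (ContinuousRep.cohomologyRes (tateLocalRep W 3 (Sum.inr ((Rat.HeightOneSpectrum.primesEquiv (R := 𝓞 ℚ)).symm ⟨3, Fact.out⟩)))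
                  (absGaloisRestrict (((Rat.HeightOneSpectrum.primesEquiv (R := 𝓞 ℚ)).symm ⟨3, Fact.out⟩).adicCompletion ℚ) ((w₀ k r).1.adicCompletion (CyclotomicField (cycLevel 3 k r) ℚ))) 1 h) =
              algebraMap (((Rat.HeightOneSpectrum.primesEquiv (R := 𝓞 ℚ)).symm ⟨3, Fact.out⟩).adicCompletion ℚ) ((w₀ k r).1.adicCompletion (CyclotomicField (cycLevel 3 k r) ℚ)) (expStarOmegaAt dK h)) ∧
          ∀ (c d a : ℤ) (A : ℕ), 0 < A → Int.gcd c (6 * 3 * A) = 1 → Int.gcd d (6 * 3 * N) = 1 →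
            ∃ (z : ∀ (k' : ℕ) (r : (cyclotomicLevelsRat 3 (badPlaces c d A N)).Ideals),
                  H1 (tateRep W 3) ((cyclotomicLevelsRat 3 (badPlaces c d A N)).level k' r.1))
              (x : ∀ (k' : ℕ) (r : (cyclotomicLevelsRat 3 (badPlaces c d A N)).Ideals),
                  CyclotomicField (cycLevel 3 k' r.1) ℚ),
              -- (C1) Euler system [Kato 2004 (8.1.3), Prop. 8.12, Ex. 13.3]
              IsEulerSystem (cyclotomicLevelsRat 3 (badPlaces c d A N)) (tateRep W 3) 3 z ∧
              -- (C2) unramified away from 3 [Kato 2004 (8.1.3), §8.2, Lemma 8.5]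
              (∀ (k : ℕ) (r : (cyclotomicLevelsRat 3 (badPlaces c d A N)).Ideals) (v : HeightOneSpectrum (𝓞 ℚ)), ((Rat.HeightOneSpectrum.primesEquiv v : Nat.Primes) : ℕ) ≠ 3 →
                  ∀ 𝔓 ∈ v.primesAbove,
                    resLe (tateRep W 3).toTopRep
                        (inf_le_left : (cyclotomicLevelsRat 3 (badPlaces c d A N)).level k r.1 ⊓ 𝔓.inertia (absoluteGaloisGroup ℚ) ≤ (cyclotomicLevelsRat 3 (badPlaces c d A N)).level k r.1)
                        1 (z k r) = 0) ∧
              -- (C4) Kato's Thm. 9.7 for the DEFINED value datum `katoLambda` (single completion, twist family)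
              (∀ (k : ℕ) (r : (cyclotomicLevelsRat 3 (badPlaces c d A N)).Ideals),
                katoLambda W 3 k r.1 (w₀ k r.1) (Ψ k r.1) (hΨ k r.1) (three_mem_asIdeal_extension _ (w₀ k r.1))
                  (g k r.1) (hg k r.1) (dw k r.1) (hinjw k r.1) (hexw k r.1) (z k r) = (1 : ℚ_[3]) ⊗ₜ[ℚ] x k r) ∧
              -- (C5) the value law [Kato 2004 Thm. 9.7 ∘ Thm. 6.6 (1)]
              (∀ (k : ℕ) (r : (cyclotomicLevelsRat 3 (badPlaces c d A N)).Ideals) (d' : ℤ) (χ : DirichletCharacter ℂ (cycLevel 3 k r.1)) (Lχ : ℂ → ℂ),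
                  Int.gcd (c * d) (cycLevel 3 k r.1 * A) = 1 →
                  d * d' ≡ 1 [ZMOD (A : ℤ)] →
                  IsDepletedTwistedL P.f (cycLevel 3 k r.1) (3 * A) χ Lχ →
                    (χ (-1) = 1 →
                      charSum (cycLevel 3 k r.1) (ι (cycLevel 3 k r.1)) χ (x k r) =
                        (κK : ℂ) * (Lχ 1 / (plusPeriod P.f : ℂ)) *
                          cuspFactor P.f true (fun n ↦ χ⁻¹ (n : ZMod (cycLevel 3 k r.1))) c d a A d') ∧
                    (χ (-1) = -1 →
                      charSum (cycLevel 3 k r.1) (ι (cycLevel 3 k r.1)) χ (x k r) =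
                        -(κK : ℂ) * (Lχ 1 / (Complex.I * (minusPeriod P.f : ℂ))) *
                          cuspFactor P.f false (fun n ↦ χ⁻¹ (n : ZMod (cycLevel 3 k r.1))) c d a A d'))) :
    ∀ (W : WeierstrassCurve ℚ) [W.IsElliptic] [W.IsGloballyMinimal]
      [ContinuousSMul ℤ_[3] (W.tateModule 3)] [Module.Free ℤ_[3] (W.tateModule 3)]
      [Module.Finite ℤ_[3] (W.tateModule 3)],
      (∀ m : ℕ, W.HasSurjectiveModNGaloisRep (3 ^ m : ℕ)) →
      (haveI : Fact (Nat.Prime 3) := ⟨Nat.prime_three⟩; Addv W 3) →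
      ¬ 3 ∣ (W.baseChange ℚ_[3]).localTamagawaNumber ℤ_[3] →
      Nat.card {Q : (W.baseChange ℚ_[3]).toAffine.Point // (3 : ℕ) • Q = 0} = 1 →
      ∀ {N : ℕ} [NeZero N] (P : ModularParametrizationData W N), N = W.conductorNorm ℤ →
        (∀ z ∈ P.L.lattice, ∃ w ∈ periodLattice P.f, z = P.c * w) →
        ¬ (3 : ℤ) ∣ P.maninConstant →
        haveI : Fact (((3 : ℕ) : 𝓞 ℚ) ∈ ((Rat.HeightOneSpectrum.primesEquiv (R := 𝓞 ℚ)).symm ⟨3, Fact.out⟩).asIdeal) :=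
          ⟨(natCast_mem_asIdeal_iff_eq_primesEquiv_symm _ Nat.prime_three).mpr rfl⟩
        letI := valuativeRelPlace ((Rat.HeightOneSpectrum.primesEquiv (R := 𝓞 ℚ)).symm ⟨3, Fact.out⟩)
        letI := topologicalSpacePlace ((Rat.HeightOneSpectrum.primesEquiv (R := 𝓞 ℚ)).symm ⟨3, Fact.out⟩)
        haveI := isNonarchimedeanLocalField_place ((Rat.HeightOneSpectrum.primesEquiv (R := 𝓞 ℚ)).symm ⟨3, Fact.out⟩)
        haveI := charZero_place ((Rat.HeightOneSpectrum.primesEquiv (R := 𝓞 ℚ)).symm ⟨3, Fact.out⟩)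
        letI := padicAlgebraPlace 3 ((Rat.HeightOneSpectrum.primesEquiv (R := 𝓞 ℚ)).symm ⟨3, Fact.out⟩)
        haveI := fact_not_isUnit_place 3 ((Rat.HeightOneSpectrum.primesEquiv (R := 𝓞 ℚ)).symm ⟨3, Fact.out⟩)
        haveI := isAdicComplete_place 3 ((Rat.HeightOneSpectrum.primesEquiv (R := 𝓞 ℚ)).symm ⟨3, Fact.out⟩)
        ∃ (d : LocalNeronLineAt W 3 ((Rat.HeightOneSpectrum.primesEquiv (R := 𝓞 ℚ)).symm ⟨3, Fact.out⟩)),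
        ∃ (ι : (n : ℕ) → (CyclotomicField n ℚ →+* ℂ)) (κK : ℝ)
          (Ψ : ∀ (k' : ℕ) (r : Finset (HeightOneSpectrum (𝓞 ℚ))), ℚ_[3] ⊗[ℚ] CyclotomicField (cycLevel 3 k' r) ℚ ≃ₐ[ℚ]
            (Π w : (((Rat.HeightOneSpectrum.primesEquiv (R := 𝓞 ℚ)).symm ⟨3, Fact.out⟩).Extension (𝓞 (CyclotomicField (cycLevel 3 k' r) ℚ))), w.1.adicCompletion (CyclotomicField (cycLevel 3 k' r) ℚ)))
          (hΨ : ∀ (k' : ℕ) (r : Finset (HeightOneSpectrum (𝓞 ℚ))) (s : ℚ_[3]) (x : CyclotomicField (cycLevel 3 k' r) ℚ) (w : (((Rat.HeightOneSpectrum.primesEquiv (R := 𝓞 ℚ)).symm ⟨3, Fact.out⟩).Extension (𝓞 (CyclotomicField (cycLevel 3 k' r) ℚ)))),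
            Ψ k' r (s ⊗ₜ[ℚ] x) w = algebraMap (CyclotomicField (cycLevel 3 k' r) ℚ) (w.1.adicCompletion (CyclotomicField (cycLevel 3 k' r) ℚ)) x *
              algebraMap (((Rat.HeightOneSpectrum.primesEquiv (R := 𝓞 ℚ)).symm ⟨3, Fact.out⟩).adicCompletion ℚ) (w.1.adicCompletion (CyclotomicField (cycLevel 3 k' r) ℚ)) ((Padic.adicCompletionEquiv (𝓞 ℚ) ⟨3, Fact.out⟩) s))
          (w₀ : ∀ (k' : ℕ) (r : Finset (HeightOneSpectrum (𝓞 ℚ))), (((Rat.HeightOneSpectrum.primesEquiv (R := 𝓞 ℚ)).symm ⟨3, Fact.out⟩).Extension (𝓞 (CyclotomicField (cycLevel 3 k' r) ℚ))))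
          (g : ∀ (k' : ℕ) (r : Finset (HeightOneSpectrum (𝓞 ℚ))), (((Rat.HeightOneSpectrum.primesEquiv (R := 𝓞 ℚ)).symm ⟨3, Fact.out⟩).Extension (𝓞 (CyclotomicField (cycLevel 3 k' r) ℚ))) → absoluteGaloisGroup ℚ)
          (hg : ∀ (k' : ℕ) (r : Finset (HeightOneSpectrum (𝓞 ℚ))) (w : (((Rat.HeightOneSpectrum.primesEquiv (R := 𝓞 ℚ)).symm ⟨3, Fact.out⟩).Extension (𝓞 (CyclotomicField (cycLevel 3 k' r) ℚ)))),
            sigma (cycLevel 3 k' r) (modNCyclotomicCharacter ℚ (cycLevel 3 k' r) (g k' r w)) • w.1 = (w₀ k' r).1)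
          (dw : ∀ (k' : ℕ) (r : Finset (HeightOneSpectrum (𝓞 ℚ))),
            letI := LocalField.charZero_adicCompletion (w₀ k' r).1
            letI := LocalField.adicCompletionPadicAlgebra (w₀ k' r).1 3 (three_mem_asIdeal_extension _ (w₀ k' r))
            haveI : Fact (¬ IsUnit ((3 : ℕ) : integerC ((w₀ k' r).1.adicCompletion (CyclotomicField (cycLevel 3 k' r) ℚ)))) := ⟨not_isUnit_natCast_integerC (LocalField.valuation_adicCompletion_natCast_lt_one (w₀ k' r).1 3 (three_mem_asIdeal_extension _ (w₀ k' r)))⟩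
            haveI := isAdicComplete_integerC_natCast (LocalField.valuation_adicCompletion_natCast_lt_one (w₀ k' r).1 3 (three_mem_asIdeal_extension _ (w₀ k' r)))
            LocalNeronLine W (LocalField.valuation_adicCompletion_natCast_lt_one (w₀ k' r).1 3 (three_mem_asIdeal_extension _ (w₀ k' r))) ((galRestrictPlace ((Rat.HeightOneSpectrum.primesEquiv (R := 𝓞 ℚ)).symm ⟨3, Fact.out⟩)).comp (absGaloisRestrict (((Rat.HeightOneSpectrum.primesEquiv (R := 𝓞 ℚ)).symm ⟨3, Fact.out⟩).adicCompletion ℚ) ((w₀ k' r).1.adicCompletion (CyclotomicField (cycLevel 3 k' r) ℚ)))))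
          (hinjw : ∀ (k' : ℕ) (r : Finset (HeightOneSpectrum (𝓞 ℚ))),
            letI := LocalField.charZero_adicCompletion (w₀ k' r).1
            letI := LocalField.adicCompletionPadicAlgebra (w₀ k' r).1 3 (three_mem_asIdeal_extension _ (w₀ k' r))
            haveI : Fact (¬ IsUnit ((3 : ℕ) : integerC ((w₀ k' r).1.adicCompletion (CyclotomicField (cycLevel 3 k' r) ℚ)))) := ⟨not_isUnit_natCast_integerC (LocalField.valuation_adicCompletion_natCast_lt_one (w₀ k' r).1 3 (three_mem_asIdeal_extension _ (w₀ k' r)))⟩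
            haveI := isAdicComplete_integerC_natCast (LocalField.valuation_adicCompletion_natCast_lt_one (w₀ k' r).1 3 (three_mem_asIdeal_extension _ (w₀ k' r)))
            (bdRPeriodRingData (LocalField.valuation_adicCompletion_natCast_lt_one (w₀ k' r).1 3 (three_mem_asIdeal_extension _ (w₀ k' r)))).CupLogInjective (logCyclotomic 3) (localRationalTateRep W 3 ((galRestrictPlace ((Rat.HeightOneSpectrum.primesEquiv (R := 𝓞 ℚ)).symm ⟨3, Fact.out⟩)).comp (absGaloisRestrict (((Rat.HeightOneSpectrum.primesEquiv (R := 𝓞 ℚ)).symm ⟨3, Fact.out⟩).adicCompletion ℚ) ((w₀ k' r).1.adicCompletion (CyclotomicField (cycLevel 3 k' r) ℚ))))))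
          (hexw : ∀ (k' : ℕ) (r : Finset (HeightOneSpectrum (𝓞 ℚ))),
            letI := LocalField.charZero_adicCompletion (w₀ k' r).1
            letI := LocalField.adicCompletionPadicAlgebra (w₀ k' r).1 3 (three_mem_asIdeal_extension _ (w₀ k' r))
            haveI : Fact (¬ IsUnit ((3 : ℕ) : integerC ((w₀ k' r).1.adicCompletion (CyclotomicField (cycLevel 3 k' r) ℚ)))) := ⟨not_isUnit_natCast_integerC (LocalField.valuation_adicCompletion_natCast_lt_one (w₀ k' r).1 3 (three_mem_asIdeal_extension _ (w₀ k' r)))⟩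
            haveI := isAdicComplete_integerC_natCast (LocalField.valuation_adicCompletion_natCast_lt_one (w₀ k' r).1 3 (three_mem_asIdeal_extension _ (w₀ k' r)))
            ∀ z : contOneCocycles (localRationalTateRep W 3 ((galRestrictPlace ((Rat.HeightOneSpectrum.primesEquiv (R := 𝓞 ℚ)).symm ⟨3, Fact.out⟩)).comp (absGaloisRestrict (((Rat.HeightOneSpectrum.primesEquiv (R := 𝓞 ℚ)).symm ⟨3, Fact.out⟩).adicCompletion ℚ) ((w₀ k' r).1.adicCompletion (CyclotomicField (cycLevel 3 k' r) ℚ))))).toTopRep,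
              (bdRPeriodRingData (LocalField.valuation_adicCompletion_natCast_lt_one (w₀ k' r).1 3 (three_mem_asIdeal_extension _ (w₀ k' r)))).HasDualExp (logCyclotomic 3) (localRationalTateRep W 3 ((galRestrictPlace ((Rat.HeightOneSpectrum.primesEquiv (R := 𝓞 ℚ)).symm ⟨3, Fact.out⟩)).comp (absGaloisRestrict (((Rat.HeightOneSpectrum.primesEquiv (R := 𝓞 ℚ)).symm ⟨3, Fact.out⟩).adicCompletion ℚ) ((w₀ k' r).1.adicCompletion (CyclotomicField (cycLevel 3 k' r) ℚ))))) fun σ => z.1 σ),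
          κK ≠ 0 ∧
          (∃ u : ℚ, (u : ℝ) = κK ∧
            ∀ (hinj : (bdRPeriodRingData (valuation_place_lt_one 3 ((Rat.HeightOneSpectrum.primesEquiv (R := 𝓞 ℚ)).symm ⟨3, Fact.out⟩))).CupLogInjective (logCyclotomic 3)
            (localRationalTateRep W 3 (galRestrictPlace ((Rat.HeightOneSpectrum.primesEquiv (R := 𝓞 ℚ)).symm ⟨3, Fact.out⟩))))
            (hex : ∀ z : contOneCocycles (localRationalTateRep W 3 (galRestrictPlace ((Rat.HeightOneSpectrum.primesEquiv (R := 𝓞 ℚ)).symm ⟨3, Fact.out⟩))).toTopRep,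
            (bdRPeriodRingData (valuation_place_lt_one 3 ((Rat.HeightOneSpectrum.primesEquiv (R := 𝓞 ℚ)).symm ⟨3, Fact.out⟩))).HasDualExp (logCyclotomic 3)
            (localRationalTateRep W 3 (galRestrictPlace ((Rat.HeightOneSpectrum.primesEquiv (R := 𝓞 ℚ)).symm ⟨3, Fact.out⟩))) fun σ => z.1 σ)
              (e : ((Rat.HeightOneSpectrum.primesEquiv (R := 𝓞 ℚ)).symm ⟨3, Fact.out⟩).adicCompletion ℚ) (he : e ≠ 0),
              (∀ a : ℚ_[3], (∃ y, (expStarOmegaPadicAt (d.smul e he) hinj hex (((Padic.adicCompletionEquiv (𝓞 ℚ) ⟨3, Fact.out⟩).symm : (((Rat.HeightOneSpectrum.primesEquiv (R := 𝓞 ℚ)).symm ⟨3, Fact.out⟩).adicCompletion ℚ) →+* ℚ_[3]))) y = a) ↔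
                ∀ Q : (W.baseChange ℚ_[3]).toAffine.Point, ‖a * padicLog (W.baseChange ℚ_[3]) Q‖ ≤ 1) →
              padicValRat 3 u = ((((Padic.adicCompletionEquiv (𝓞 ℚ) ⟨3, Fact.out⟩).symm : (((Rat.HeightOneSpectrum.primesEquiv (R := 𝓞 ℚ)).symm ⟨3, Fact.out⟩).adicCompletion ℚ) →+* ℚ_[3])) e).valuation) ∧
          (∀ (k' : ℕ) (r : Finset (HeightOneSpectrum (𝓞 ℚ))),
            letI := LocalField.charZero_adicCompletion (w₀ k' r).1
            letI := LocalField.adicCompletionPadicAlgebra (w₀ k' r).1 3 (three_mem_asIdeal_extension _ (w₀ k' r))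
            haveI : Fact (¬ IsUnit ((3 : ℕ) : integerC ((w₀ k' r).1.adicCompletion (CyclotomicField (cycLevel 3 k' r) ℚ)))) := ⟨not_isUnit_natCast_integerC (LocalField.valuation_adicCompletion_natCast_lt_one (w₀ k' r).1 3 (three_mem_asIdeal_extension _ (w₀ k' r)))⟩
            haveI := isAdicComplete_integerC_natCast (LocalField.valuation_adicCompletion_natCast_lt_one (w₀ k' r).1 3 (three_mem_asIdeal_extension _ (w₀ k' r)))
            ∀ (h : (tateLocalRep W 3 (Sum.inr ((Rat.HeightOneSpectrum.primesEquiv (R := 𝓞 ℚ)).symm ⟨3, Fact.out⟩))).cohomology 1),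
              expStarOmegaHom (LocalField.valuation_adicCompletion_natCast_lt_one (w₀ k' r).1 3 (three_mem_asIdeal_extension _ (w₀ k' r))) ((galRestrictPlace ((Rat.HeightOneSpectrum.primesEquiv (R := 𝓞 ℚ)).symm ⟨3, Fact.out⟩)).comp (absGaloisRestrict (((Rat.HeightOneSpectrum.primesEquiv (R := 𝓞 ℚ)).symm ⟨3, Fact.out⟩).adicCompletion ℚ) ((w₀ k' r).1.adicCompletion (CyclotomicField (cycLevel 3 k' r) ℚ)))) (dw k' r) (hinjw k' r) (hexw k' r)
                (ContinuousRep.cohomologyRes (tateLocalRep W 3 (Sum.inr ((Rat.HeightOneSpectrum.primesEquiv (R := 𝓞 ℚ)).symm ⟨3, Fact.out⟩))) (absGaloisRestrict (((Rat.HeightOneSpectrum.primesEquiv (R := 𝓞 ℚ)).symm ⟨3, Fact.out⟩).adicCompletion ℚ) ((w₀ k' r).1.adicCompletion (CyclotomicField (cycLevel 3 k' r) ℚ))) 1 h) =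
              algebraMap (((Rat.HeightOneSpectrum.primesEquiv (R := 𝓞 ℚ)).symm ⟨3, Fact.out⟩).adicCompletion ℚ) ((w₀ k' r).1.adicCompletion (CyclotomicField (cycLevel 3 k' r) ℚ)) (expStarOmegaAt d h)) ∧
          ∀ (c d a : ℤ) (A : ℕ), 0 < A → Int.gcd c (6 * 3 * A) = 1 → Int.gcd d (6 * 3 * N) = 1 →
            ∃ (z : ∀ (k' : ℕ) (r : (cyclotomicLevelsRat 3 (badPlaces c d A N)).Ideals),
                  H1 (tateRep W 3) ((cyclotomicLevelsRat 3 (badPlaces c d A N)).level k' r.1))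
              (x : ∀ (k' : ℕ) (r : (cyclotomicLevelsRat 3 (badPlaces c d A N)).Ideals),
                  CyclotomicField (cycLevel 3 k' r.1) ℚ),
              ZetaBody W 3 P.f ι κK
                (fun k' r => katoLambda W 3 k' r (w₀ k' r) (Ψ k' r) (hΨ k' r) (three_mem_asIdeal_extension _ (w₀ k' r)) (g k' r) (hg k' r) (dw k' r) (hinjw k' r) (hexw k' r))
                c d a A z x := by
  intro W _ _ _ _ _ htow hadd hc3 ht N _ P hN hlat hman
  haveI : Fact (((3 : ℕ) : 𝓞 ℚ) ∈ ((Rat.HeightOneSpectrum.primesEquiv (R := 𝓞 ℚ)).symm ⟨3, Fact.out⟩).asIdeal) :=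
    ⟨(natCast_mem_asIdeal_iff_eq_primesEquiv_symm _ Nat.prime_three).mpr rfl⟩
  letI := valuativeRelPlace ((Rat.HeightOneSpectrum.primesEquiv (R := 𝓞 ℚ)).symm ⟨3, Fact.out⟩)
  letI := topologicalSpacePlace ((Rat.HeightOneSpectrum.primesEquiv (R := 𝓞 ℚ)).symm ⟨3, Fact.out⟩)
  haveI := isNonarchimedeanLocalField_place ((Rat.HeightOneSpectrum.primesEquiv (R := 𝓞 ℚ)).symm ⟨3, Fact.out⟩)
  haveI := charZero_place ((Rat.HeightOneSpectrum.primesEquiv (R := 𝓞 ℚ)).symm ⟨3, Fact.out⟩)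
  letI := padicAlgebraPlace 3 ((Rat.HeightOneSpectrum.primesEquiv (R := 𝓞 ℚ)).symm ⟨3, Fact.out⟩)
  haveI := fact_not_isUnit_place 3 ((Rat.HeightOneSpectrum.primesEquiv (R := 𝓞 ℚ)).symm ⟨3, Fact.out⟩)
  haveI := isAdicComplete_place 3 ((Rat.HeightOneSpectrum.primesEquiv (R := 𝓞 ℚ)).symm ⟨3, Fact.out⟩)
  obtain ⟨dK, ι, κK, w₀, Ψ, hΨ, g, hg, dw, hinjw, hexw, hκ0, hpos, hRES, hz⟩ := hKatoPrintPos₀ W htow hadd hc3 ht P hN hlat hman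
  -- Kato's Prop. 1.2.3 binders at `v₃` from the cite facts (w2-c3), in this statement's instance spelling
  obtain ⟨hinj, hex⟩ :
      (bdRPeriodRingData (valuation_place_lt_one 3 ((Rat.HeightOneSpectrum.primesEquiv (R := 𝓞 ℚ)).symm ⟨3, Fact.out⟩))).CupLogInjective (logCyclotomic 3)
          (localRationalTateRep W 3 (galRestrictPlace ((Rat.HeightOneSpectrum.primesEquiv (R := 𝓞 ℚ)).symm ⟨3, Fact.out⟩))) ∧
        ∀ z : contOneCocycles (localRationalTateRep W 3 (galRestrictPlace ((Rat.HeightOneSpectrum.primesEquiv (R := 𝓞 ℚ)).symm ⟨3, Fact.out⟩))).toTopRep,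
          (bdRPeriodRingData (valuation_place_lt_one 3 ((Rat.HeightOneSpectrum.primesEquiv (R := 𝓞 ℚ)).symm ⟨3, Fact.out⟩))).HasDualExp (logCyclotomic 3)
            (localRationalTateRep W 3 (galRestrictPlace ((Rat.HeightOneSpectrum.primesEquiv (R := 𝓞 ℚ)).symm ⟨3, Fact.out⟩))) fun σ => z.1 σ :=
    hinj_hex_of_facts W 3 ((Rat.HeightOneSpectrum.primesEquiv (R := 𝓞 ℚ)).symm ⟨3, Fact.out⟩) hP hDR
  -- a class with `exp*_{dK} ≠ 0`, on every row, from (S5b) (w2-c3)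
  have hne : ∃ y, expStarOmegaAt dK y ≠ 0 :=
    exists_expStarOmegaAt_ne_zero_of_facts W 3 ((Rat.HeightOneSpectrum.primesEquiv (R := 𝓞 ℚ)).symm ⟨3, Fact.out⟩) hT dK hinj hex
  refine ⟨dK, ι, κK, Ψ, hΨ, w₀, g, hg, dw, hinjw, hexw, hκ0, hpos, hRES, ?_⟩
  -- `ZetaBody` = (C1) ∧ (C2) ∧ (C3a) ∧ (C3b) ∧ (C4) ∧ (C5); (C3a)/(C3b) are KERNEL for `katoLambda` (w2-acc5's tool)
  intro c d a A hA hc hd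
  obtain ⟨z, x, h1, h2, h4, h5⟩ := hz c d a A hA hc hd
  have hC3 := fun (k : ℕ) (r : Finset (HeightOneSpectrum (𝓞 ℚ))) =>
    zetaBody_C3_katoLambda_of_ne_zero W k r dK hinj hex hne (Ψ k r) (hΨ k r) (w₀ k r) (g k r) (hg k r)
      (dw k r) (hinjw k r) (hexw k r) (hRES k r)
  exact ⟨z, x, h1, h2, fun k r σ y => (hC3 k r).1 σ y, fun k r y hy => (hC3 k r).2 y hy, h4, h5⟩

end Summit.BirchSwinnertonDyer.BirchSwinnertonDyer.Theorems.KimAtThreeFineKatoPrintPosition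

end
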